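import Summits.QuantumFields.YangMills.Theorems.PoincareLipschitzOneStepLinkLipschitz
import Literature.MathematicalPhysics.QuantumFieldTheory.Balaban1983to89.T3Thresholds
import Literature.MathematicalPhysics.QuantumFieldTheory.Balaban1983to89.TorusGeometry
import HarnessLib

/-!
# Crux stmt-QuantumFields-19936 `UnitScaleTilt.HistoryTailL`, line `poincare_lipschitz`: the stub `stub_levelOneLipschitz`
# (route crux `BlockLipschitzL` at `j = 1` — ONE Bałaban averaging step is link-Lipschitz on locally small fields)

The registered stub (skeleton `Cruxes/HistoryTailL/Lines/poincare_lipschitz.lean`, planner ym-r3-idea-2 g7) asks, for each `L`, for a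
constant `CL` (allowed to depend on `L`) such that for all thresholds `b₀ > 0`, `p₀ > 2` there is `γ₁ ∈ (0,1]` with: for every
`T3Family F` with `F.L = L`, every `γ ∈ (0, γ₁]`, every `K ≥ 3` (`j = 1`), every level-one plaquette `a` and every two level-zero
`SU(2)` fields `U, U'` whose level-zero plaquettes within torus distance `64(L−1)` of the corner `a.src·L` are below Bałaban's threshold
`θ(K) = θBal L γ b₀ p₀ K`, the averaged plaquette deviations satisfy
`|dist1((avg U)(∂a)) − dist1((avg U')(∂a))| ≤ CL/√L · (Σ_{b ∈ box} dist1(U_b U'_b⁻¹)²)^{1/2}`, the box being the fine bonds with both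
ends in `a.src·L + [−8L, 9L)³`.

PROOF (this file; the one-step analysis is the sibling helper `PoincareLipschitzOneStepLinkLipschitz`):
* §1 torus bookkeeping: a fine site whose block is within `{−1, 0, 1, 2}` of `a.src` coordinatewise differs from `a.src·L` by an
  integer in `[−L, 3L−1]` in each coordinate (`exists_int_rep`); hence it lies within torus distance `9L − 3` of `a.src·L`
  (`tdist_le_of_near`) and inside the window (`mem_window_of_near`); the three blocks `B(c₋ − e_{dir c}), B(c₋), B(c₊)` of each of the
  four bonds `c` of `∂a` are such blocks (`near_of_edge_block`);
* §2 thresholds: `γ₁(b₀, p₀, L)` with `θBal L γ b₀ p₀ i ≤ 1/(75(L+1)²)` at every height (`T3Thresholds.exists_gamma_forall_θBal_le`), so that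
  `((5L)²/4)·θ(K) ≤ 1/6 = δ_{SU(2)}/2` — every (0.4) loop variable at `∂a` sits in half the guard of the printed `exp[mean log]`;
* §3 the stub: `Averaging.iter (blockAvg ℰp) 1 = avgFun ℰp` and `iter 0 = id` definitionally; the hypotheses feed
  `PoincareLipschitzOneStep.abs_dist1_plaqHol_avgFun_sub_le` with `ρ :=` the box `ℓ²` link distance (each box bond has
  `‖U_b − U'_b‖ ≤ dist1(U_b U'_b⁻¹) ≤ ρ`), giving `|Δ| ≤ 4(24·5L + L)ρ = 484L·ρ`; `CL := 484·L·√L`.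

WHAT THIS IS NOT: the Schur-test constant `√L` of the line card (uniform in `L`) is not proved and not required by the registered bytes at
`j = 1`; nothing here bears on `stub_iteratedLipschitz` (`j ≥ 2`, where the `L^{-j/2}` decay is the content), on the concentration
stubs, on the crux `HistoryTailL`, on rung R3 (YM₃ on T³ — not d = 4, not infinite volume, not a mass gap, not the Clay problem).
Width seat ym-ust-19936-w5 g9 (cell ym3-torus), `--supports stmt-QuantumFields-19936`.
-/

noncomputable section

open scoped BigOperators Matrix.Norms.L2Operator

namespace Summit.QuantumFields.YangMills.Theorems.PoincareLipschitzLevelOneLipschitz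

open Literature.MathematicalPhysics.QuantumFieldTheory.Balaban1983to89
open Literature.MathematicalPhysics.QuantumFieldTheory.Balaban1983to89.T3ContinuumYM3Torus
open Literature.MathematicalPhysics.QuantumFieldTheory.Balaban1983to89.T3UnitLawDensityEML
open T4Continuum BlockAveraging AveragingRT ExpMeanLog T3UnitScaleTilt

/-! ## §1 Torus bookkeeping around a level-one plaquette -/

section Geometry

variable (F : T3Family) (K : ℕ)

/-- **INTEGER REPRESENTATIVE.**  If the block of the fine site `x` has `k`-th label in `{s, s+1, s−1, s+2}`, `s = (a₀)_k`, then
`x_k − s·L ≡ m (mod 2L^{m+K})` for an integer `m ∈ [−L, 3L−1]`. [folklore] -/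
theorem exists_int_rep (a₀ : Site (F.P K) 1) (x : Site (F.P K) 0) (k : Fin (F.P K).d)
    (hx : blockOf x k = a₀ k ∨ blockOf x k = a₀ k + 1 ∨ blockOf x k = a₀ k - 1 ∨ blockOf x k = a₀ k + 2) :
    ∃ m : ℤ, -(F.L : ℤ) ≤ m ∧ m ≤ 3 * F.L - 1 ∧
      x k - ((((a₀ k).val * F.L : ℕ)) : ZMod ((F.P K).sitesPerDir 0)) = (m : ZMod ((F.P K).sitesPerDir 0)) := by
  have hPL : (F.P K).L = F.L := rfl
  have h01 : 0 + 1 ≤ (F.P K).m + (F.P K).K := by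
    show 0 + 1 ≤ F.m + K
    have := F.hm; omega
  set N0 : ℕ := (F.P K).sitesPerDir 0 with hN0
  set N1 : ℕ := (F.P K).sitesPerDir 1 with hN1
  have hN : N0 = N1 * F.L := by rw [hN0, hN1, ← hPL]; exact (F.P K).sitesPerDir_eq_mul_succ h01
  have hN' : (N0 : ℤ) = (N1 : ℤ) * F.L := by rw [hN]; push_cast; ring
  have hL0 : 0 < F.L := by have := F.hL.2; omega
  set v : ℕ := (x k).val with hv
  set u : ℕ := (blockOf x k).val with hu
  set t : ℕ := (a₀ k).val with ht
  have huv : u = v / F.L := by rw [hu, hv, ← hPL]; exact Site.val_blockOf h01 x k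
  -- the offset `e ∈ {0, 1, -1, 2}` with `u ≡ t + e (mod N1)`
  obtain ⟨e, he1, he2, hdvd⟩ : ∃ e : ℤ, -1 ≤ e ∧ e ≤ 2 ∧ (N1 : ℤ) ∣ (u : ℤ) - (t + e) := by
    have hcast : ∀ e : ℤ, blockOf x k = a₀ k + (e : ZMod N1) → (N1 : ℤ) ∣ (u : ℤ) - (t + e) := by
      intro e h
      have h' : ((u : ℤ) : ZMod N1) = (((t : ℤ) + e : ℤ) : ZMod N1) := by
        push_cast
        rw [hu, ht, ZMod.natCast_zmod_val, ZMod.natCast_zmod_val]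
        exact h
      have := (ZMod.intCast_eq_intCast_iff_dvd_sub _ _ _).1 h'.symm
      simpa using this
    rcases hx with h | h | h | h
    · exact ⟨0, by norm_num, by norm_num, hcast 0 (by simpa using h)⟩
    · exact ⟨1, by norm_num, by norm_num, hcast 1 (by simpa using h)⟩
    · exact ⟨-1, by norm_num, by norm_num, hcast (-1) (by rw [h]; push_cast; ring)⟩
    · exact ⟨2, by norm_num, by norm_num, hcast 2 (by simpa using h)⟩
  -- `v = uL + r`, `0 ≤ r < L`
  set r : ℕ := v % F.L with hr
  have hvdec : (v : ℤ) = u * F.L + r := by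
    have h1 : F.L * (v / F.L) + v % F.L = v := Nat.div_add_mod v F.L
    rw [← huv] at h1
    have h2 : (v : ℤ) = ((F.L * u + r : ℕ) : ℤ) := by rw [h1]
    rw [h2]; push_cast; ring
  have hrL : (r : ℤ) ≤ F.L - 1 := by have : r < F.L := Nat.mod_lt _ hL0; omega
  have hr0 : (0 : ℤ) ≤ r := by positivity
  have hL1 : (1 : ℤ) ≤ F.L := by exact_mod_cast hL0
  refine ⟨r + e * F.L, by nlinarith, by nlinarith, ?_⟩
  -- `x_k − tL = (v − tL : ℤ) = (u − t − e)L + (r + eL) ≡ r + eL (mod N0)`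
  have hxk : x k = ((v : ℤ) : ZMod N0) := by rw [hv, Int.cast_natCast, ZMod.natCast_zmod_val]
  rw [hxk, show ((((a₀ k).val * F.L : ℕ)) : ZMod N0) = (((t : ℤ) * F.L : ℤ) : ZMod N0) by rw [ht]; push_cast; rfl,
    ← Int.cast_sub, ZMod.intCast_eq_intCast_iff_dvd_sub]
  obtain ⟨q, hq⟩ := hdvd
  exact ⟨-q, by rw [hvdec, hN']; linear_combination (-(F.L : ℤ)) * hq⟩

variable {F K}

/-- A representative bounds the torus length of a residue: `min ((m : ZMod N).val, (−m : ZMod N).val) ≤ |m|` for `|m| < N`. [folklore] -/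
theorem min_val_le_natAbs {N : ℕ} [NeZero N] (m : ℤ) (hm : m.natAbs < N) :
    min ((m : ZMod N)).val ((-(m : ZMod N))).val ≤ m.natAbs := by
  have hc : ((m.natAbs : ℕ) : ZMod N) = ((|m| : ℤ) : ZMod N) := by
    rw [← Int.cast_natCast (R := ZMod N), Int.natCast_natAbs]
  rcases le_or_gt 0 m with h | h
  · have : ((m : ZMod N)).val = m.natAbs := by
      rw [show (m : ZMod N) = ((m.natAbs : ℕ) : ZMod N) by rw [hc, abs_of_nonneg h], ZMod.val_natCast,
        Nat.mod_eq_of_lt hm]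
    rw [this]; exact min_le_left _ _
  · have : ((-(m : ZMod N))).val = m.natAbs := by
      rw [show -(m : ZMod N) = ((m.natAbs : ℕ) : ZMod N) by rw [hc, abs_of_neg h, Int.cast_neg], ZMod.val_natCast,
        Nat.mod_eq_of_lt hm]
    rw [this]; exact min_le_right _ _

/-- `2L^{m+K} ≥ 18L` once `K ≥ 2`: the level-zero torus is much longer than the block neighbourhoods used here (`L ≥ 3`, `m ≥ 1`).
[folklore] -/
theorem sitesPerDir_zero_ge (F : T3Family) {K : ℕ} (hK : 2 ≤ K) : 18 * F.L ≤ (F.P K).sitesPerDir 0 := by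
  have hL3 : 3 ≤ F.L := (by obtain ⟨k, hk⟩ := F.hL.1; have := F.hL.2; omega)
  have hm := F.hm
  show 18 * F.L ≤ 2 * F.L ^ (F.m + K - 0)
  rw [Nat.sub_zero]
  have h1 : F.L ^ 3 ≤ F.L ^ (F.m + K) := Nat.pow_le_pow_right (by omega) (by omega)
  have h2 : 9 * F.L ≤ F.L ^ 3 := by
    rw [pow_succ, pow_two]
    nlinarith
  omega

/-- **TORUS DISTANCE TO THE CORNER.**  A fine site whose block is within `{−1,0,1,2}` of `a₀` coordinatewise is within torus distance
`9L − 3` of `a₀·L` (`K ≥ 2`). [folklore] -/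
theorem tdist_le_of_near (hK : 2 ≤ K) (a₀ : Site (F.P K) 1) (x : Site (F.P K) 0)
    (hx : ∀ k, blockOf x k = a₀ k ∨ blockOf x k = a₀ k + 1 ∨ blockOf x k = a₀ k - 1 ∨ blockOf x k = a₀ k + 2) :
    Site.tdist x (fun k => ((((a₀ k).val * F.L : ℕ)) : ZMod ((F.P K).sitesPerDir 0))) ≤ 3 * (3 * F.L - 1) := by
  have hL3 : 3 ≤ F.L := (by obtain ⟨k, hk⟩ := F.hL.1; have := F.hL.2; omega)
  have hbig := sitesPerDir_zero_ge F hK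
  unfold Site.tdist
  have hd : (F.P K).d = 3 := rfl
  calc ∑ μ : Fin (F.P K).d, min (x μ - ((((a₀ μ).val * F.L : ℕ)) : ZMod ((F.P K).sitesPerDir 0))).val
          (((((a₀ μ).val * F.L : ℕ)) : ZMod ((F.P K).sitesPerDir 0)) - x μ).val
      ≤ ∑ _μ : Fin (F.P K).d, (3 * F.L - 1) := by
        refine Finset.sum_le_sum fun k _ => ?_
        obtain ⟨m, hm1, hm2, hmeq⟩ := exists_int_rep F K a₀ x k (hx k)
        have hmabs : m.natAbs ≤ 3 * F.L - 1 := by omega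
        have hmN : m.natAbs < (F.P K).sitesPerDir 0 := by omega
        rw [← neg_sub (x k), hmeq]
        exact (min_val_le_natAbs m hmN).trans hmabs
    _ = 3 * (3 * F.L - 1) := by rw [Finset.sum_const, Finset.card_univ, Fintype.card_fin, hd, smul_eq_mul]

/-- **THE WINDOW.**  A fine site whose block is within `{−1,0,1,2}` of `a₀` coordinatewise lies in the window `a₀·L + [−8L, 9L)³`
(`K ≥ 2`). [folklore] -/
theorem mem_window_of_near (hK : 2 ≤ K) (a₀ : Site (F.P K) 1) (x : Site (F.P K) 0)
    (hx : ∀ k, blockOf x k = a₀ k ∨ blockOf x k = a₀ k + 1 ∨ blockOf x k = a₀ k - 1 ∨ blockOf x k = a₀ k + 2) (k : Fin (F.P K).d) :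
    (x k - ((((a₀ k).val * F.L ^ 1 : ℕ)) : ZMod ((F.P K).sitesPerDir 0)) +
        ((8 * F.L ^ 1 : ℕ) : ZMod ((F.P K).sitesPerDir 0))).val < 17 * F.L ^ 1 := by
  have hL3 : 3 ≤ F.L := (by obtain ⟨k, hk⟩ := F.hL.1; have := F.hL.2; omega)
  have hbig := sitesPerDir_zero_ge F hK
  rw [pow_one]
  obtain ⟨m, hm1, hm2, hmeq⟩ := exists_int_rep F K a₀ x k (hx k)
  have hnn : 0 ≤ m + 8 * F.L := by omega
  rw [hmeq, show (m : ZMod ((F.P K).sitesPerDir 0)) + ((8 * F.L : ℕ) : ZMod ((F.P K).sitesPerDir 0)) =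
    (((m + 8 * F.L).toNat : ℕ) : ZMod ((F.P K).sitesPerDir 0)) by
      rw [← Int.cast_natCast (R := ZMod ((F.P K).sitesPerDir 0)) (m + 8 * F.L).toNat, Int.toNat_of_nonneg hnn]
      push_cast; ring]
  rw [ZMod.val_natCast, Nat.mod_eq_of_lt (by omega)]
  omega

/-- **THE BLOCKS AROUND `∂a`.**  For each of the four bonds `c` of the level-one plaquette `a`, the three blocks `B(c₋ − e_{dir c})`,
`B(c₋)`, `B(c₊)` have labels within `{−1, 0, 1, 2}` of `a.src` coordinatewise. [folklore] -/
theorem near_of_edge_block {P : Params} {j : ℕ} (a : Plaq P (j + 1)) (c : PBond P (j + 1))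
    (hc : c = ⟨a.src, a.μ⟩ ∨ c = ⟨a.src.shift a.μ, a.ν⟩ ∨ c = ⟨a.src.shift a.ν, a.μ⟩ ∨ c = ⟨a.src, a.ν⟩)
    (y : Site P (j + 1)) (hy : y = c.src.unshift c.dir ∨ y = c.src ∨ y = c.tgt) (k : Fin P.d) :
    y k = a.src k ∨ y k = a.src k + 1 ∨ y k = a.src k - 1 ∨ y k = a.src k + 2 := by
  obtain ⟨x, μ, ν, hμν⟩ := a
  by_cases hkμ : k = μ
  · subst hkμ
    have hkν : k ≠ ν := ne_of_lt hμν
    rcases hc with rfl | rfl | rfl | rfl <;> rcases hy with rfl | rfl | rfl <;>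
      simp only [PBond.tgt, Site.shift, Site.unshift, Function.update_self, Function.update_of_ne hkν, true_or, or_true]
  · by_cases hkν : k = ν
    · subst hkν
      rcases hc with rfl | rfl | rfl | rfl <;> rcases hy with rfl | rfl | rfl <;>
        simp only [PBond.tgt, Site.shift, Site.unshift, Function.update_self, Function.update_of_ne hkμ, true_or, or_true]
    · rcases hc with rfl | rfl | rfl | rfl <;> rcases hy with rfl | rfl | rfl <;>
        simp only [PBond.tgt, Site.shift, Site.unshift, Function.update_of_ne hkμ, Function.update_of_ne hkν, true_or]

end Geometry

/-! ## §2 Two small facts about `SU(2)` -/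

section SU2

/-- `δ_{SU(2)} = min(1/3, π/2) = 1/3`, so `1/6 ≤ δ_{SU(2)}/2`. [folklore] -/
theorem sixth_le_half_deltaSU_two : (1 : ℝ) / 6 ≤ deltaSU (Fin 2) / 2 := by
  unfold deltaSU
  rw [Fintype.card_fin]
  have : (1 : ℝ) / 3 ≤ min (1 / 3) (Real.pi / (2 : ℕ)) := le_min le_rfl (by push_cast; linarith [Real.pi_gt_three])
  linarith

/-- `‖g − h‖ ≤ dist1 (g h⁻¹)` in `SU(N)` (`g − h = (g h⁻¹ − 1) h`, `‖h‖ = 1`). [folklore] -/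
theorem norm_coe_sub_le_dist1 {n : Type*} [Fintype n] [DecidableEq n] [Nonempty n] (g h : Matrix.specialUnitaryGroup n ℂ) :
    ‖(g : Matrix n n ℂ) - (h : Matrix n n ℂ)‖ ≤ dist1 (g * h⁻¹) := by
  have hh : ‖(h : Matrix n n ℂ)‖ = 1 := CStarRing.norm_of_mem_unitary (Matrix.mem_specialUnitaryGroup_iff.1 h.2).1
  have e : (g : Matrix n n ℂ) - (h : Matrix n n ℂ) = (((g * h⁻¹ : Matrix.specialUnitaryGroup n ℂ) : Matrix n n ℂ) - 1) * (h : Matrix n n ℂ) := by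
    rw [sub_mul, one_mul, ← Submonoid.coe_mul, inv_mul_cancel_right]
  rw [e, FederbushMean.dist1_SU_eq]
  calc _ ≤ ‖((g * h⁻¹ : Matrix.specialUnitaryGroup n ℂ) : Matrix n n ℂ) - 1‖ * ‖(h : Matrix n n ℂ)‖ := norm_mul_le _ _
    _ = _ := by rw [hh, mul_one]

end SU2

/-! ## §3 The stub `stub_levelOneLipschitz` (route crux `BlockLipschitzL` at `j = 1`) -/

section Stub

/-- ★ **`stub_levelOneLipschitz`** (crux stmt-QuantumFields-19936, line `poincare_lipschitz`, registered signature VERBATIM): one Bałaban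
averaging step `U ↦ dist1((avg U)(∂a))` is link-Lipschitz in the box `ℓ²` metric on pairs of level-zero `SU(2)` fields that are
locally small around the level-one plaquette `a`, with constant `CL/√L`, `CL := 484·L·√L`. [cite: Balaban1987RG1, (0.4) p.253] -/
theorem stub_levelOneLipschitz :
    open Literature.MathematicalPhysics.QuantumFieldTheory.Balaban1983to89 Literature.MathematicalPhysics.QuantumFieldTheory.Balaban1983to89.T3ContinuumYM3Torus in ∀ (L : ℕ), ∃ CL : ℝ, 0 ≤ CL ∧ ∀ (b₀ p₀ : ℝ), 0 < b₀ → 2 < p₀ → ∃ γ₁ : ℝ, 0 < γ₁ ∧ γ₁ ≤ 1 ∧ ∀ (F : T3Family) (γ : ℝ), F.L = L → 0 < γ → γ ≤ γ₁ → ∀ (K j : ℕ), 1 ≤ j → j + 2 ≤ K → j ≤ 1 → ∀ (a : Plaq (F.P K) j) (U U' : GaugeField (F.P K) 0 (Matrix.specialUnitaryGroup (Fin 2) ℂ)), (∀ (i : ℕ) (q : Plaq (F.P K) i), i < j → Site.tdist (fun k => ((((q.src k).val * F.L ^ i : ℕ)) : ZMod ((F.P K).sitesPerDir 0))) (fun k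 => ((((a.src k).val * F.L ^ j : ℕ)) : ZMod ((F.P K).sitesPerDir 0))) + 64 * F.L ^ i ≤ 64 * F.L ^ j → GaugeGroup.dist1 (GaugeField.plaqHol (Averaging.iter (fun i' => BlockAveraging.blockAvg (P := F.P K) (j := i') T3UnitLawDensityEML.ℰp) i U) q) < T3UnitScaleTilt.θBal F.L γ b₀ p₀ (K - i)) → (∀ (i : ℕ) (q : Plaq (F.P K) i), i < j → Site.tdist (fun k => ((((q.src k).val * F.L ^ i : ℕ)) : ZMod ((F.P K).sitesPerDir 0))) (fun k => ((((a.src k).val * F.L ^ j : ℕ)) : ZMod ((F.P K).sitesPerDir 0))) + 64 * F.L ^ i ≤ 64 * F.L ^ j → GaugeGroup.dist1 (GaugeField.plaqHol (Averaging.iter (fun i' => BlockAveraging.blockAvg (P := F.P K) (j := i') T3UnitLawDensityEML.ℰp) i U') q) < T3UnitScaleTilt.θBal F.L γ b₀ p₀ (K - i)) → |GaugeGroup.dist1 (GaugeField.plaqHol (Averaging.iter (fun i' => BlockAveraging.blockAvg (P := F.P K) (j := i') T3UnitLawDensityEML.ℰp) j U) a) - GaugeGroup.dist1 (GaugeField.plaqHol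 (Averaging.iter (fun i' => BlockAveraging.blockAvg (P := F.P K) (j := i') T3UnitLawDensityEML.ℰp) j U') a)| ≤ CL / Real.sqrt ((F.L : ℝ) ^ j) * Real.sqrt (∑ b : PBond (F.P K) 0, if (∀ k, (b.src k - ((((a.src k).val * F.L ^ j : ℕ)) : ZMod ((F.P K).sitesPerDir 0)) + ((8 * F.L ^ j : ℕ) : ZMod ((F.P K).sitesPerDir 0))).val < 17 * F.L ^ j) ∧ (∀ k, (b.tgt k - ((((a.src k).val * F.L ^ j : ℕ)) : ZMod ((F.P K).sitesPerDir 0)) + ((8 * F.L ^ j : ℕ) : ZMod ((F.P K).sitesPerDir 0))).val < 17 * F.L ^ j) then GaugeGroup.dist1 (U b * (U' b)⁻¹) ^ 2 else 0) := by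
  intro L
  refine ⟨484 * L * Real.sqrt L, by positivity, ?_⟩
  intro b₀ p₀ hb hp
  obtain ⟨γ₁, hγ₁, hγ₁1, hθσ⟩ := T3Thresholds.exists_gamma_forall_θBal_le (b₀ := b₀) (p₀ := p₀) hb (by linarith)
    (σ := 1 / (75 * ((L : ℝ) + 1) ^ 2)) (by positivity)
  refine ⟨γ₁, hγ₁, hγ₁1, ?_⟩
  intro F γ hFL hγ hγγ₁ K j hj1 hjK hj1' a U U' hU hU'
  obtain rfl : j = 1 := le_antisymm hj1' hj1
  subst hFL
  have hK2 : 2 ≤ K := by omega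
  have hL3 : 3 ≤ F.L := (by obtain ⟨k, hk⟩ := F.hL.1; have := F.hL.2; omega)
  have h01 : 0 + 1 ≤ (F.P K).m + (F.P K).K := by
    show 0 + 1 ≤ F.m + K
    have := F.hm; omega
  -- the threshold at height `K` and the half-guard
  have hθ0 : 0 ≤ θBal F.L γ b₀ p₀ K :=
    (T3MinimiserStabilityReduction.θBal_pos (by omega) hγ (hγγ₁.trans hγ₁1) hb p₀ K).le
  have hθσ' : θBal F.L γ b₀ p₀ K ≤ 1 / (75 * ((F.L : ℝ) + 1) ^ 2) := hθσ F.L (by omega) γ hγ hγγ₁ K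
  have hθδ : ((((F.P K).d + 2) * (F.P K).L : ℕ) : ℝ) ^ 2 / 4 * θBal F.L γ b₀ p₀ K ≤ deltaSU (Fin 2) / 2 := by
    have e5 : ((((F.P K).d + 2) * (F.P K).L : ℕ) : ℝ) = 5 * F.L := by
      show ((((3 + 2) * F.L : ℕ)) : ℝ) = 5 * F.L
      push_cast; ring
    rw [e5]
    have h1 : (5 * (F.L : ℝ)) ^ 2 / 4 * (1 / (75 * ((F.L : ℝ) + 1) ^ 2)) = (F.L : ℝ) ^ 2 / (12 * ((F.L : ℝ) + 1) ^ 2) := by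
      field_simp; ring
    have h2 : (F.L : ℝ) ^ 2 / (12 * ((F.L : ℝ) + 1) ^ 2) ≤ 1 / 6 := by
      rw [div_le_div_iff₀ (by positivity) (by norm_num)]
      nlinarith
    calc (5 * (F.L : ℝ)) ^ 2 / 4 * θBal F.L γ b₀ p₀ K ≤ (5 * (F.L : ℝ)) ^ 2 / 4 * (1 / (75 * ((F.L : ℝ) + 1) ^ 2)) :=
          mul_le_mul_of_nonneg_left hθσ' (by positivity)
      _ ≤ 1 / 6 := by rw [h1]; exact h2
      _ ≤ deltaSU (Fin 2) / 2 := sixth_le_half_deltaSU_two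
  -- the local smallness hypotheses, read on the blocks around `∂a`
  have hloc : ∀ V : GaugeField (F.P K) 0 (Matrix.specialUnitaryGroup (Fin 2) ℂ),
      (∀ (i : ℕ) (q : Plaq (F.P K) i), i < 1 →
        Site.tdist (fun k => ((((q.src k).val * F.L ^ i : ℕ)) : ZMod ((F.P K).sitesPerDir 0)))
            (fun k => ((((a.src k).val * F.L ^ 1 : ℕ)) : ZMod ((F.P K).sitesPerDir 0))) + 64 * F.L ^ i ≤ 64 * F.L ^ 1 →
          dist1 (GaugeField.plaqHol (Averaging.iter (fun i' => BlockAveraging.blockAvg (P := F.P K) (j := i') ℰp) i V) q) <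
            θBal F.L γ b₀ p₀ (K - i)) →
      ∀ c : PBond (F.P K) 1, (c = ⟨a.src, a.μ⟩ ∨ c = ⟨a.src.shift a.μ, a.ν⟩ ∨ c = ⟨a.src.shift a.ν, a.μ⟩ ∨ c = ⟨a.src, a.ν⟩) →
        ∀ q : Plaq (F.P K) 0, (blockOf q.src = c.src.unshift c.dir ∨ blockOf q.src = c.src ∨ blockOf q.src = c.tgt) →
          dist1 (GaugeField.plaqHol V q) < θBal F.L γ b₀ p₀ K := by
    intro V hV c hc q hq
    have hnear : ∀ k, blockOf q.src k = a.src k ∨ blockOf q.src k = a.src k + 1 ∨ blockOf q.src k = a.src k - 1 ∨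
        blockOf q.src k = a.src k + 2 := fun k => near_of_edge_block a c hc (blockOf q.src) hq k
    have htd := tdist_le_of_near hK2 a.src q.src hnear
    have e0 : (fun k => ((((q.src k).val * F.L ^ 0 : ℕ)) : ZMod ((F.P K).sitesPerDir 0))) = q.src := by
      funext k; rw [pow_zero, mul_one, ZMod.natCast_zmod_val]
    have h := hV 0 q zero_lt_one (by rw [e0, pow_one, pow_zero, mul_one]; omega)
    simpa [Averaging.iter] using h
  -- the box `ℓ²` link distance
  set S : ℝ := ∑ b : PBond (F.P K) 0, (if (∀ k, (b.src k - ((((a.src k).val * F.L ^ 1 : ℕ)) : ZMod ((F.P K).sitesPerDir 0)) +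
      ((8 * F.L ^ 1 : ℕ) : ZMod ((F.P K).sitesPerDir 0))).val < 17 * F.L ^ 1) ∧
      (∀ k, (b.tgt k - ((((a.src k).val * F.L ^ 1 : ℕ)) : ZMod ((F.P K).sitesPerDir 0)) +
      ((8 * F.L ^ 1 : ℕ) : ZMod ((F.P K).sitesPerDir 0))).val < 17 * F.L ^ 1) then dist1 (U b * (U' b)⁻¹) ^ 2 else 0) with hS
  have hterm : ∀ b : PBond (F.P K) 0, 0 ≤ (if (∀ k, (b.src k - ((((a.src k).val * F.L ^ 1 : ℕ)) : ZMod ((F.P K).sitesPerDir 0)) +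
      ((8 * F.L ^ 1 : ℕ) : ZMod ((F.P K).sitesPerDir 0))).val < 17 * F.L ^ 1) ∧
      (∀ k, (b.tgt k - ((((a.src k).val * F.L ^ 1 : ℕ)) : ZMod ((F.P K).sitesPerDir 0)) +
      ((8 * F.L ^ 1 : ℕ) : ZMod ((F.P K).sitesPerDir 0))).val < 17 * F.L ^ 1) then dist1 (U b * (U' b)⁻¹) ^ 2 else (0 : ℝ)) :=
    fun b => by split_ifs <;> positivity
  have hρ0 : 0 ≤ Real.sqrt S := Real.sqrt_nonneg _
  have hUU' : ∀ c : PBond (F.P K) 1, (c = ⟨a.src, a.μ⟩ ∨ c = ⟨a.src.shift a.μ, a.ν⟩ ∨ c = ⟨a.src.shift a.ν, a.μ⟩ ∨ c = ⟨a.src, a.ν⟩) →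
      ∀ b : PBond (F.P K) 0, (blockOf b.src = c.src ∨ blockOf b.src = c.tgt) → (blockOf b.tgt = c.src ∨ blockOf b.tgt = c.tgt) →
        ‖((U b : Matrix.specialUnitaryGroup (Fin 2) ℂ) : Matrix (Fin 2) (Fin 2) ℂ) - (U' b : Matrix (Fin 2) (Fin 2) ℂ)‖ ≤ Real.sqrt S := by
    intro c hc b hbs hbt
    have hws : ∀ k, (b.src k - ((((a.src k).val * F.L ^ 1 : ℕ)) : ZMod ((F.P K).sitesPerDir 0)) +
        ((8 * F.L ^ 1 : ℕ) : ZMod ((F.P K).sitesPerDir 0))).val < 17 * F.L ^ 1 := fun k =>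
      mem_window_of_near hK2 a.src b.src (fun k => near_of_edge_block a c hc (blockOf b.src)
        (by rcases hbs with h | h; exacts [Or.inr (Or.inl h), Or.inr (Or.inr h)]) k) k
    have hwt : ∀ k, (b.tgt k - ((((a.src k).val * F.L ^ 1 : ℕ)) : ZMod ((F.P K).sitesPerDir 0)) +
        ((8 * F.L ^ 1 : ℕ) : ZMod ((F.P K).sitesPerDir 0))).val < 17 * F.L ^ 1 := fun k =>
      mem_window_of_near hK2 a.src b.tgt (fun k => near_of_edge_block a c hc (blockOf b.tgt)
        (by rcases hbt with h | h; exacts [Or.inr (Or.inl h), Or.inr (Or.inr h)]) k) k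
    have hle : dist1 (U b * (U' b)⁻¹) ^ 2 ≤ S := by
      have h := Finset.single_le_sum (f := fun b : PBond (F.P K) 0 =>
        (if (∀ k, (b.src k - ((((a.src k).val * F.L ^ 1 : ℕ)) : ZMod ((F.P K).sitesPerDir 0)) +
          ((8 * F.L ^ 1 : ℕ) : ZMod ((F.P K).sitesPerDir 0))).val < 17 * F.L ^ 1) ∧
          (∀ k, (b.tgt k - ((((a.src k).val * F.L ^ 1 : ℕ)) : ZMod ((F.P K).sitesPerDir 0)) +
          ((8 * F.L ^ 1 : ℕ) : ZMod ((F.P K).sitesPerDir 0))).val < 17 * F.L ^ 1) then dist1 (U b * (U' b)⁻¹) ^ 2 else (0 : ℝ)))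
        (fun b _ => hterm b) (Finset.mem_univ b)
      simp only [hws, hwt, implies_true, and_self, if_true] at h
      exact h
    calc _ ≤ dist1 (U b * (U' b)⁻¹) := norm_coe_sub_le_dist1 _ _
      _ = Real.sqrt (dist1 (U b * (U' b)⁻¹) ^ 2) := (Real.sqrt_sq (GaugeGroup.dist1_nonneg _)).symm
      _ ≤ Real.sqrt S := Real.sqrt_le_sqrt hle
  -- the one-step estimate
  have key := PoincareLipschitzOneStep.abs_dist1_plaqHol_avgFun_sub_le (n := Fin 2) h01 U U' a hθ0 hθδ
    (hloc U hU) (hloc U' hU') hρ0 hUU'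
  have hiter : ∀ V : GaugeField (F.P K) 0 (Matrix.specialUnitaryGroup (Fin 2) ℂ),
      Averaging.iter (fun i' => BlockAveraging.blockAvg (P := F.P K) (j := i') ℰp) 1 V = avgFun ℰp V := fun V => rfl
  rw [hiter U, hiter U']
  refine key.trans (le_of_eq ?_)
  have e5 : ((((F.P K).d + 2) * (F.P K).L : ℕ) : ℝ) = 5 * F.L := by
    show ((((3 + 2) * F.L : ℕ)) : ℝ) = 5 * F.L
    push_cast; ring
  have ePL : ((F.P K).L : ℝ) = F.L := rfl
  have hsq : 0 < Real.sqrt (F.L : ℝ) := Real.sqrt_pos.mpr (by positivity)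
  rw [e5, ePL, pow_one, mul_div_assoc, div_self hsq.ne', mul_one]
  ring

end Stub

end Summit.QuantumFields.YangMills.Theorems.PoincareLipschitzLevelOneLipschitz
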